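import Summits.AnomalousDissipation.AnomalousDissipation.Theorems.SolenoidalFractalHomogenisationLagrangianStepOneLevelSplitApiL
import Summits.AnomalousDissipation.AnomalousDissipation.Theorems.SolenoidalFractalHomogenisationLagrangianStepCellClauseCutsW
import Summits.AnomalousDissipation.AnomalousDissipation.Theorems.SolenoidalFractalHomogenisationLagrangianStepCellClauseCutsFamily
import Summits.AnomalousDissipation.AnomalousDissipation.Theorems.SolenoidalFractalHomogenisationLagrangianStepOneLevelGlueLowerFamily
import Summits.AnomalousDissipation.AnomalousDissipation.Theorems.SolenoidalFractalHomogenisationLagrangianStepWindowLedgerAbs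
import Summits.AnomalousDissipation.AnomalousDissipation.Theorems.SolenoidalFractalHomogenisationLagrangianStepLedgerTrim
import Summits.AnomalousDissipation.AnomalousDissipation.Theorems.SolenoidalFractalHomogenisationLagrangianStepDatumTrim
import Summits.AnomalousDissipation.AnomalousDissipation.Theorems.SolenoidalFractalHomogenisationLagrangianStepClassTruncate
import Summits.AnomalousDissipation.AnomalousDissipation.Theorems.SolenoidalFractalHomogenisationLagrangianStepBaseT
import Literature.Analysis.FluidPDE.PassiveVectorTensorPropagator
import HarnessLib

/-!
# K1L_D `LagrangianRenormalisationStepDesign` (stmt-AnomalousDissipation-27980), stub `stub_oneLevelL_IW` v3-cut-2: the GLUE of the AMENDED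
# one-level cut (helper; `--supports stmt-AnomalousDissipation-27980 --as helper`; tenure D24-11 (a′))

`oneLevelL_IW_of_piecesL : S0′-text → S23″-text → (the v2′ registered text of stub_oneLevelL_IW, VERBATIM)`, sorry-free.  Supersedes the
three-piece glue `oneLevelL_IW_of_pieces` (`…OneLevelSplitGlue`, p648767; it stays, a true implication) after the lead's findings while typing S23′:
F-lead-4 (the last window must be long: grid `gridL`), F-lead-5 (the datum must be trimmed to a band `|ℓ| ≤ Lc` chosen inside S23; the class-`R`
tail is paid HERE, decay-relatively), F-lead-7 (no slow cut: the stub S3d′ is gone) and the spec P1–P4 (lead 16:52:50Z; consent in advance).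
The two binder types are the stub texts S0′ `stub_windowPropagatorL` (byte-unchanged; discharged by `windowPropagatorL`, p648539) and S23″
`stub_windowDefectL` of the reference file `Summits/AnomalousDissipation/AnomalousDissipation/Cruxes/LagrangianRenormalisationStep/OneLevelSplitSketch.lean`
(rev6, planner ad-ideate-p4 g11), over the shared data definitions `V2 datumLp cutLp` (`…OneLevelSplitDefs`) and `gridL seqL` (`…OneLevelSplitDefsL`)
and the Literature propagator spec `Torus.IsPropagator`.  Registry v3 then PROVES `stub_oneLevelL_IW` as
`oneLevelL_IW_of_piecesL stub_windowPropagatorL stub_windowDefectL` with S23″ sorried byte-for-byte (tenure D24-8 (ii) / D24-11).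

PROOF (real-variable, ≈ 190 lines): constants `C₁ := 2(3Cη + 12Cg) + 18·Cτ/(4π²) + 3`, `σ₁ := min (min ση σg) (στ/2)`; `m⋆` and the trim level
`Lc` from S23″; both propagators `U^m`, `U^(m+1)` from S0′ (tensors `NearIso (kbar·lo) (kbar·hi)` by `nearIso_renormStep` + `NearIso.smul`); the
trimmed datum `w₁ := P_Lc w₀` is a band-limited class-`R` datum (`isDatum_fourierTruncate`, `inClass_fourierTruncate`,
`fourierTruncate_fourierTruncate`); `u t`, `v t` are represented through `repr` at `s = 0` for a.e. `t ∈ (1/2,1)`, intersected with the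
`stub_baseT` floor `(1 − e^(−4π² kbar_m lo))‖x‖² ≤ drop_v(t)`; the ledger `window_ledger_abs` runs on `x₁ := datumLp w₁` along the `gridL` of `t`
(`T_j := U^m(w_j,w_(j+1))`, `K := ⌊t/refresh⌋₊+1`, `gridL K = t`, `γ_j := ‖g_j‖`, junk `≤ 12 Cg ρ^σg D₁`); P4: `trim_compare` (`…LedgerTrim`) with
`T₀ := U^m_(0→t)`, `T₁ := U^(m+1)_(0→t)`, the orthogonal split `x = x₁ + (x − x₁)`, `x₁ = cutLp Lc x` (`datumLp_fourierTruncate`, `inner_cutLp_self`)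
and `ε := min ε₁ 1`; the tail `4π²‖x − x₁‖² ≤ Cτ ρ^στ D` from the S23″ export `R ≤ Cτ ρ^στ Lc² (1 − e^(−4π² kbar_m lo))`, the spectral gap
`norm_sub_cutLp_sq_le_of_inClass` and the `stub_baseT` floor; `6‖x₂‖√D + 15‖x₂‖² ≤ (18 Cτ/(4π²) + 3) ρ^(στ/2) D` by AM–GM with weight `ρ^(στ/2)`
(`ρ > 0` by `N_pos`, `ρ ≤ 1` by the `N²` separation).  WHAT THIS IS NOT: not a proof of S23″, of the crux K1L_D, of Onsager's conjecture or of
anomalous dissipation; rung F-D1.A0 infrastructure.  Text by planner seat `ad-ideate-p4` g11 (2026-08-28); landed by a prover seat (Summits/Theorems is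
prover-only, D-0016).
-/

set_option linter.dupNamespace false

noncomputable section

namespace Summit.AnomalousDissipation.AnomalousDissipation.Theorems.SolenoidalFractalHomogenisation.LagrangianStep

open Literature.Analysis Literature.Analysis.FluidPDE Literature.Analysis.FunctionSpaces
open MeasureTheory Set Filter ContinuousLinearMap
open scoped ENNReal NNReal InnerProductSpace
open Summit.AnomalousDissipation.AnomalousDissipation.Theorems.SolenoidalFractalHomogenisation.RealisedQuasiStaticCellLaw
open Summit.AnomalousDissipation.AnomalousDissipation.Theorems.SolenoidalFractalHomogenisation.LagrangianRenormalisationStep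
open OneLevelSplit

set_option maxHeartbeats 400000 in
/-- **The amended one-level cut composes (v3-cut-2).**  `S0′ → S23″ → stub_oneLevelL_IW` (v2′ text verbatim): both propagators from S0′; the datum is
trimmed to `w₁ := P_{Lc} w₀` (again a class-`R` datum, band-limited); the energy ledger `window_ledger_abs` runs on `x₁ := datumLp w₁` along the
`gridL` of `t`; the trimmed-off tail `x₂ := x − x₁ ⊥ x₁` is restored by `trim_compare`, its budget `‖x₂‖² ≤ (Cτ/4π²)·ρ^στ·drop_v` coming from the
S23″ export, the spectral gap and `stub_baseT`. -/
theorem oneLevelL_IW_of_piecesL :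
    (∀ k (E : LatticeShear.LagrangianLatticeCarrier k), E.LPermissible → E.Regular →
    ∀ (m : ℕ) (𝔸 : Torus.Visc4 (Fin 3)) (lo hi : ℝ), 0 < lo → Torus.NearIso 𝔸 lo hi →
      ∃ U : ℝ → ℝ → (V2 →L[ℝ] V2), Torus.IsPropagator 1 (E.partialSum m) 𝔸 U) →
    (∀ k (W : Literature.Analysis.FluidPDE.LatticeShear.LatticeWord k) (M : ℝ) (hM : 0 < M) (c : ℝ), 0 < c →
    ∀ (Φ : ℝ → Torus.Visc4 (Fin 3) → Torus.Visc4 (Fin 3)) (lo hi Λ β σ C ν₀ K Cf νf Kf : ℝ),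
      0 < lo → lo ≤ 1 → 1 ≤ hi → 1 < Λ → 0 ≤ β →
      0 < σ → 0 ≤ C → 0 < ν₀ → 0 < K → SlowVectorClauseF W M hM c Φ lo hi Λ β σ C ν₀ K →
      0 ≤ Cf → 0 < νf → 0 < Kf → CellEnergyClausesW W M hM c lo hi Λ β Cf νf Kf →
      ∃ ν₁ > (0:ℝ), ∃ K₁ > (0:ℝ), ∃ Λ₀ : ℕ, ∃ θ₀ > (0:ℝ), ∃ Cη > (0:ℝ), ∃ ση > (0:ℝ), ∃ Cg > (0:ℝ), ∃ σg > (0:ℝ), ∃ Cτ > (0:ℝ), ∃ στ > (0:ℝ),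
        ∀ E : Literature.Analysis.FluidPDE.LatticeShear.LagrangianLatticeCarrier k, E.design = W.stretch M hM → E.gain = c → E.nu0 ≤ ν₁ → K₁ ≤ E.K →
          E.LPermissible → E.Regular → (∀ m, Λ₀ * E.N m ≤ E.N (m + 1)) → (∀ m, E.N m ^ 2 ≤ E.N (m + 1)) →
          (∀ m, E.cellVisc (m + 1) * ((E.N (m + 1) : ℝ) / E.N m) ^ (1 / 4 : ℝ) ≤ 1) →
          (∀ m, E.K * ((E.N (m + 1) : ℝ) / E.N m) ^ (1 / 4 : ℝ) ≤ ((E.N (m + 1) : ℝ) / E.N m) * E.cellVisc (m + 1)) →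
          (∀ m, E.θ (m + 1) * ((E.N (m + 1) : ℝ) / E.N m) ^ (1 / 16 : ℝ) ≤ θ₀) →
          (∀ m, ((E.N (m + 1) : ℝ) / E.N m) ^ (1 / 16 : ℝ) * E.physPeriod (m + 1) ≤ E.refresh (m + 1)) →
        ∀ R : ℝ≥0, ∃ mstar : ℕ, ∀ m, mstar ≤ m →
          ∃ Lc : ℕ,
          (R : ℝ) ≤ Cτ * ((E.N m : ℝ) / E.N (m + 1)) ^ στ * (Lc : ℝ) ^ 2 * (1 - Real.exp (-(4 * Real.pi ^ 2 * (E.kbar m * lo)))) ∧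
          Cη * ((E.N m : ℝ) / E.N (m + 1)) ^ ση ≤ 1 / 8 ∧
          ∀ S : Torus.Visc4 (Fin 3), Torus.OddSmall S β → Torus.NearIso S lo hi →
            Torus.OddSmall (Φ (E.cellVisc (m + 1)) S) β → Torus.NearIso (Φ (E.cellVisc (m + 1)) S) lo hi →
          ∀ (w₁ : VF) (hw₁ : IsDatum w₁), InClass R w₁ → Torus.fourierTruncate Lc w₁ = w₁ →
          ∀ Um Um1 : ℝ → ℝ → (V2 →L[ℝ] V2),
            Torus.IsPropagator 1 (E.partialSum m) (E.kbar m • renormStep (Φ (E.cellVisc (m + 1))) (E.gain / E.cellVisc (m + 1) ^ 2) S) Um →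
            Torus.IsPropagator 1 (E.partialSum (m + 1)) (E.kbar (m + 1) • S) Um1 →
          ∀ t ∈ Ioo (1/2 : ℝ) 1,
            ∃ (e g : ℕ → V2) (G : ℝ),
              (∀ j, seqL Um1 (datumLp w₁ hw₁) (E.refresh (m + 1)) t (j + 1) =
                  Um (gridL (E.refresh (m + 1)) t j) (gridL (E.refresh (m + 1)) t (j + 1))
                    (seqL Um1 (datumLp w₁ hw₁) (E.refresh (m + 1)) t j) + e j + g j) ∧
              (∀ j (y : V2), |⟪y, e j⟫_ℝ| ≤
                  (Cη * ((E.N m : ℝ) / E.N (m + 1)) ^ ση) *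
                    Real.sqrt (‖seqL Um1 (datumLp w₁ hw₁) (E.refresh (m + 1)) t j‖ ^ 2 -
                      ‖Um (gridL (E.refresh (m + 1)) t j) (gridL (E.refresh (m + 1)) t (j + 1))
                        (seqL Um1 (datumLp w₁ hw₁) (E.refresh (m + 1)) t j)‖ ^ 2) *
                    Real.sqrt (‖y‖ ^ 2 -
                      ‖ContinuousLinearMap.adjoint (Um (gridL (E.refresh (m + 1)) t j) (gridL (E.refresh (m + 1)) t (j + 1))) y‖ ^ 2)) ∧
              0 ≤ G ∧ (∀ K', ∑ j ∈ Finset.range K', ‖g j‖ ≤ G) ∧ G ≤ ‖datumLp w₁ hw₁‖ ∧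
              ‖datumLp w₁ hw₁‖ * G ≤
                Cg * ((E.N m : ℝ) / E.N (m + 1)) ^ σg * (‖datumLp w₁ hw₁‖ ^ 2 - ‖Um 0 t (datumLp w₁ hw₁)‖ ^ 2)) →
    ∀ k (W : Literature.Analysis.FluidPDE.LatticeShear.LatticeWord k) (M : ℝ) (hM : 0 < M) (c : ℝ), 0 < c →
    ∀ (Φ : ℝ → Torus.Visc4 (Fin 3) → Torus.Visc4 (Fin 3)) (lo hi Λ β σ C ν₀ K Cf νf Kf : ℝ),
      0 < lo → lo ≤ 1 → 1 ≤ hi → 1 < Λ → 0 ≤ β →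
      0 < σ → 0 ≤ C → 0 < ν₀ → 0 < K → SlowVectorClauseF W M hM c Φ lo hi Λ β σ C ν₀ K →
      0 ≤ Cf → 0 < νf → 0 < Kf → CellEnergyClausesW W M hM c lo hi Λ β Cf νf Kf →
      ∃ ν₁ > (0:ℝ), ∃ K₁ > (0:ℝ), ∃ Λ₀ : ℕ, ∃ θ₀ > (0:ℝ), ∃ C₁ > (0:ℝ), ∃ σ₁ > (0:ℝ),
        ∀ E : Literature.Analysis.FluidPDE.LatticeShear.LagrangianLatticeCarrier k, E.design = W.stretch M hM → E.gain = c → E.nu0 = ν₁ → E.K = K₁ → E.LPermissible → E.Regular → (∀ m, Λ₀ * E.N m ≤ E.N (m + 1)) → (∀ m, E.N m ^ 2 ≤ E.N (m + 1)) → (∀ m, E.cellVisc (m + 1) * ((E.N (m + 1) : ℝ) / E.N m) ^ (1 / 4 : ℝ) ≤ 1) → (∀ m, E.K * ((E.N (m + 1) : ℝ) / E.N m) ^ (1 / 4 : ℝ) ≤ ((E.N (m + 1) : ℝ) / E.N m) * E.cellVisc (m + 1)) → (∀ m, E.θ (m + 1) * ((E.N (m + 1) : ℝ) / E.N m) ^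 (1 / 16 : ℝ) ≤ θ₀) → (∀ m, ((E.N (m + 1) : ℝ) / E.N m) ^ (1 / 16 : ℝ) * E.physPeriod (m + 1) ≤ E.refresh (m + 1)) →
        ∀ R : ℝ≥0, ∃ mstar : ℕ, ∀ m, mstar ≤ m →
          ∀ S : Torus.Visc4 (Fin 3), Torus.OddSmall S β → Torus.NearIso S lo hi →
            Torus.OddSmall (Φ (E.cellVisc (m + 1)) S) β → Torus.NearIso (Φ (E.cellVisc (m + 1)) S) lo hi →
          ∀ (w₀ : VF), IsDatum w₀ → InClass R w₀ →
          ∀ u v : ℝ → VF, TSol E (m + 1) (E.kbar (m + 1) • S) w₀ u →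
            TSol E m (E.kbar m • renormStep (Φ (E.cellVisc (m + 1))) (E.gain / E.cellVisc (m + 1) ^ 2) S) w₀ v →
            ∀ᵐ t ∂(volume.restrict (Ioo (1/2 : ℝ) 1)),
              (1 - C₁ * ((E.N m : ℝ) / E.N (m + 1)) ^ σ₁) * drop w₀ v t ≤ drop w₀ u t := by
  intro hS0 hS23 k W M hM c hc Φ lo hi Λ β σ C ν₀ K Cf νf Kf hlo hlo1 hhi hΛ hβ hσ hC hν₀ hK hV hCf hνf hKf hF
  obtain ⟨ν₁, hν₁, K₁, hK₁, Λ₀, θ₀, hθ₀, Cη, hCη, ση, hση, Cg, hCg, σg, hσg, Cτ, hCτ, στ, hστ, hD⟩ :=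
    hS23 k W M hM c hc Φ lo hi Λ β σ C ν₀ K Cf νf Kf hlo hlo1 hhi hΛ hβ hσ hC hν₀ hK hV hCf hνf hKf hF
  refine ⟨ν₁, hν₁, K₁, hK₁, Λ₀, θ₀, hθ₀, 2 * (3 * Cη + 12 * Cg) + (18 * (Cτ / (4 * Real.pi ^ 2)) + 3), by positivity,
    min (min ση σg) (στ / 2), lt_min (lt_min hση hσg) (half_pos hστ), ?_⟩
  intro E hdes hgain hnu0 hKE hLP hReg hT2 hN2 hT3a hT3b hT4 hT5 R
  obtain ⟨m₁, hm₁⟩ := hD E hdes hgain hnu0.le hKE.symm.le hLP hReg hT2 hN2 hT3a hT3b hT4 hT5 R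
  refine ⟨m₁, fun m hm S hS₁ hS₂ hS₃ hS₄ w₀ hw₀ hR u v hu hv => ?_⟩
  obtain ⟨Lc, htrim, hη8, hDm⟩ := hm₁ m hm
  -- the two propagators from S0′
  have hgain0 : 0 ≤ E.gain := hgain ▸ hc.le
  have h𝔸v : Torus.NearIso (E.kbar m • renormStep (Φ (E.cellVisc (m + 1))) (E.gain / E.cellVisc (m + 1) ^ 2) S)
      (E.kbar m * lo) (E.kbar m * hi) :=
    (nearIso_renormStep (div_nonneg hgain0 (sq_nonneg _)) hS₂ hS₄).smul (E.kbar_pos m).le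
  have h𝔸u : Torus.NearIso (E.kbar (m + 1) • S) (E.kbar (m + 1) * lo) (E.kbar (m + 1) * hi) :=
    hS₂.smul (E.kbar_pos (m + 1)).le
  obtain ⟨Um, hUm⟩ := hS0 k E hLP hReg m _ _ _ (mul_pos (E.kbar_pos m) hlo) h𝔸v
  obtain ⟨Um1, hUm1⟩ := hS0 k E hLP hReg (m + 1) _ _ _ (mul_pos (E.kbar_pos (m + 1)) hlo) h𝔸u
  -- the trimmed datum `w₁ := P_{Lc} w₀`: again a class-`R` datum, band-limited
  have hw₀2 : MemLp w₀ 2 volume := memLp_two_of_memSobolev_one_complexify hw₀.1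
  have hw₁ : IsDatum (Torus.fourierTruncate Lc w₀) := isDatum_fourierTruncate hw₀ Lc
  have hR₁ : InClass R (Torus.fourierTruncate Lc w₀) := inClass_fourierTruncate hw₀2 hR Lc
  have hband : Torus.fourierTruncate Lc (Torus.fourierTruncate Lc w₀) = Torus.fourierTruncate Lc w₀ :=
    fourierTruncate_fourierTruncate (hw₀2.integrable one_le_two) Lc
  -- a.e. representation of `u t` and `v t` through the propagators, and the `stub_baseT` floor of `drop_v`
  have hrepu := hUm1.repr 0 le_rfl zero_lt_one w₀ hw₀2 hw₀.2.2 u (by simpa only [TSol, sub_zero, zero_add] using hu)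
  have hrepv := hUm.repr 0 le_rfl zero_lt_one w₀ hw₀2 hw₀.2.2 v (by simpa only [TSol, sub_zero, zero_add] using hv)
  have hbase := stub_baseT k E hLP hReg m _ _ _ (mul_pos (E.kbar_pos m) hlo) h𝔸v w₀ v hw₀ hv
  have hsub : Ioo (1/2 : ℝ) 1 ⊆ Ioo 0 (1 - 0) := by
    rw [sub_zero]; exact Ioo_subset_Ioo (by norm_num) le_rfl
  filter_upwards [ae_restrict_of_ae_restrict_of_subset hsub hrepu, ae_restrict_of_ae_restrict_of_subset hsub hrepv, hbase,
    ae_restrict_mem measurableSet_Ioo] with t hu1 hv1 hbt ht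
  obtain ⟨hut, hute⟩ := hu1
  obtain ⟨hvt, hvte⟩ := hv1
  rw [zero_add] at hute hvte
  have ht0 : 0 ≤ t := by linarith [ht.1]
  have ht1 : t ≤ 1 := ht.2.le
  have hr : 0 < E.refresh (m + 1) := E.refresh_pos (m + 1)
  -- names: the datum class `x`, its trimmed part `x₁ = cutLp Lc x`, the tail `x₂ := x - x₁`
  set x : V2 := datumLp w₀ hw₀ with hx_def
  set x₁ : V2 := datumLp (Torus.fourierTruncate Lc w₀) hw₁ with hx₁_def
  have hx₁ : x₁ = cutLp Lc x := datumLp_fourierTruncate hw₀ Lc hw₁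
  -- energies through the propagators
  have hEu : ∫ a, ‖u t a‖ ^ 2 = ‖Um1 0 t x‖ ^ 2 := by
    rw [← norm_toLp_sq hut, hute]; rfl
  have hEv : ∫ a, ‖v t a‖ ^ 2 = ‖Um 0 t x‖ ^ 2 := by
    rw [← norm_toLp_sq hvt, hvte]; rfl
  have hE0 : Torus.vectorL2Sq w₀ = ‖x‖ ^ 2 := (norm_datumLp_sq w₀ hw₀).symm
  -- the per-window decomposition (S23″) for the trimmed datum
  obtain ⟨e, g, G, hdec, hDD, hG0, hGsum, hGle, hGpay⟩ :=
    hDm S hS₁ hS₂ hS₃ hS₄ (Torus.fourierTruncate Lc w₀) hw₁ hR₁ hband Um Um1 hUm hUm1 t ht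
  -- the ledger on the `gridL` of `t`, for `x₁`
  set ρ : ℝ := (E.N m : ℝ) / E.N (m + 1) with hρ_def
  have hρ0 : 0 ≤ ρ := rho_nonneg _ _
  have hρ1 : ρ ≤ 1 := rho_le_one (hN2 m)
  have hρpos : 0 < ρ := div_pos (Nat.cast_pos.2 (E.N_pos m)) (Nat.cast_pos.2 (E.N_pos (m + 1)))
  have hη0 : 0 ≤ Cη * ρ ^ ση := mul_nonneg hCη.le (Real.rpow_nonneg hρ0 _)
  have hvs : ∀ j, seqL Um x₁ (E.refresh (m + 1)) t (j + 1) =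
      Um (gridL (E.refresh (m + 1)) t j) (gridL (E.refresh (m + 1)) t (j + 1)) (seqL Um x₁ (E.refresh (m + 1)) t j) := by
    intro j
    cases j with
    | zero => rw [seqL_succ, seqL_zero, gridL_zero]
    | succ j =>
      rw [seqL_succ, seqL_succ,
        hUm.comp 0 _ _ le_rfl (gridL_nonneg hr.le ht0 _) (gridL_mono hr.le ht0 _) ((gridL_le hr.le ht0 _).trans ht1)]
  have hL := window_ledger_abs
    (fun j => Um (gridL (E.refresh (m + 1)) t j) (gridL (E.refresh (m + 1)) t (j + 1)))
    (fun j y => hUm.norm_le _ _ y)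
    (seqL Um1 x₁ (E.refresh (m + 1)) t) (seqL Um x₁ (E.refresh (m + 1)) t) e g (fun j => ‖g j‖) (Cη * ρ ^ ση) hη0 hη8
    (fun j => norm_nonneg _) rfl hvs hdec (fun j => le_rfl) hDD
    (⌊t / E.refresh (m + 1)⌋₊ + 1)
  have hsumG : ∑ j ∈ Finset.range (⌊t / E.refresh (m + 1)⌋₊ + 1), ‖g j‖ ≤ G := hGsum _
  have hsum0 : 0 ≤ ∑ j ∈ Finset.range (⌊t / E.refresh (m + 1)⌋₊ + 1), ‖g j‖ := Finset.sum_nonneg fun j _ => norm_nonneg _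
  -- read the ledger at `K = ⌊t/refresh⌋₊ + 1`, where `gridL K = t`
  have hKt : gridL (E.refresh (m + 1)) t (⌊t / E.refresh (m + 1)⌋₊ + 1) = t := gridL_floor_succ hr
  have huK : seqL Um1 x₁ (E.refresh (m + 1)) t (⌊t / E.refresh (m + 1)⌋₊ + 1) = Um1 0 t x₁ := by rw [seqL_succ, hKt]
  have hvK : seqL Um x₁ (E.refresh (m + 1)) t (⌊t / E.refresh (m + 1)⌋₊ + 1) = Um 0 t x₁ := by rw [seqL_succ, hKt]
  have hv0 : seqL Um x₁ (E.refresh (m + 1)) t 0 = x₁ := rfl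
  rw [huK, hvK, hv0] at hL
  -- the trimmed ledger: `‖U¹ x₁‖² ≤ ‖U⁰ x₁‖² + ε₁ D₁`
  set D₁ : ℝ := ‖x₁‖ ^ 2 - ‖Um 0 t x₁‖ ^ 2 with hD₁_def
  have hv₁le : ‖Um 0 t x₁‖ ≤ ‖x₁‖ := hUm.norm_le _ _ _
  have hD₁0 : 0 ≤ D₁ := by rw [hD₁_def]; exact sub_nonneg.2 (pow_le_pow_left₀ (norm_nonneg _) hv₁le 2)
  have hGG : G * G ≤ ‖x₁‖ * G := mul_le_mul_of_nonneg_right hGle hG0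
  have hjunk : 6 * (‖x₁‖ + ∑ j ∈ Finset.range (⌊t / E.refresh (m + 1)⌋₊ + 1), ‖g j‖) *
      ∑ j ∈ Finset.range (⌊t / E.refresh (m + 1)⌋₊ + 1), ‖g j‖ ≤ 12 * (Cg * ρ ^ σg * D₁) := by
    calc 6 * (‖x₁‖ + ∑ j ∈ Finset.range (⌊t / E.refresh (m + 1)⌋₊ + 1), ‖g j‖) *
          ∑ j ∈ Finset.range (⌊t / E.refresh (m + 1)⌋₊ + 1), ‖g j‖
        ≤ 6 * ((‖x₁‖ + G) * G) := by
          rw [mul_assoc]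
          exact mul_le_mul_of_nonneg_left (mul_le_mul (by linarith only [hsumG]) hsumG hsum0 (by positivity)) (by norm_num)
      _ = 6 * (‖x₁‖ * G) + 6 * (G * G) := by ring
      _ ≤ 6 * (‖x₁‖ * G) + 6 * (‖x₁‖ * G) := by linarith only [hGG]
      _ = 12 * (‖x₁‖ * G) := by ring
      _ ≤ 12 * (Cg * ρ ^ σg * D₁) := by linarith only [hGpay]
  set ε₁ : ℝ := 3 * (Cη * ρ ^ ση) + 12 * (Cg * ρ ^ σg) with hε₁_def
  have hε₁0 : 0 ≤ ε₁ := by positivity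
  have hmain₁ : ‖Um1 0 t x₁‖ ^ 2 ≤ ‖Um 0 t x₁‖ ^ 2 + ε₁ * D₁ := by
    rw [hε₁_def, hD₁_def]; rw [hD₁_def] at hjunk; linarith only [hL, hjunk]
  -- (P4) trim: restore the tail `x₂ := x - x₁ ⊥ x₁` with `trim_compare`, `ε := min ε₁ 1`
  have horth : ⟪x₁, x - x₁⟫_ℝ = 0 := by
    rw [inner_sub_right, real_inner_self_eq_norm_sq, hx₁, real_inner_comm, inner_cutLp_self, sub_self]
  have hledger : ‖Um1 0 t x₁‖ ^ 2 ≤ ‖Um 0 t x₁‖ ^ 2 + min ε₁ 1 * D₁ := by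
    rcases min_cases ε₁ 1 with ⟨h, _⟩ | ⟨h, _⟩
    · rw [h]; exact hmain₁
    · rw [h, one_mul, hD₁_def]
      linarith only [pow_le_pow_left₀ (norm_nonneg _) (hUm1.norm_le 0 t x₁) 2]
  have htc := trim_compare (Um 0 t) (Um1 0 t) (fun y => hUm.norm_le _ _ y) (fun y => hUm1.norm_le _ _ y) x₁ (x - x₁) horth
    (le_min hε₁0 zero_le_one) (min_le_right _ _) hledger
  rw [add_sub_cancel] at htc
  -- the tail budget: `4π² ‖x₂‖² ≤ Cτ ρ^στ · D` from the export, the spectral gap and the `stub_baseT` floor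
  set D : ℝ := ‖x‖ ^ 2 - ‖Um 0 t x‖ ^ 2 with hD_def
  have hvle : ‖Um 0 t x‖ ≤ ‖x‖ := hUm.norm_le _ _ _
  have hD0 : 0 ≤ D := by rw [hD_def]; exact sub_nonneg.2 (pow_le_pow_left₀ (norm_nonneg _) hvle 2)
  set B : ℝ := 1 - Real.exp (-(4 * Real.pi ^ 2 * (E.kbar m * lo))) with hB_def
  have hBD : B * ‖x‖ ^ 2 ≤ D := by
    have := hbt; simp only [drop] at this; rw [hEv, hE0] at this; exact this
  set A : ℝ := ‖x - x₁‖ ^ 2 with hA_def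
  have hgap : 4 * Real.pi ^ 2 * ((Lc : ℝ) ^ 2 + 1) * A ≤ (R : ℝ) * ‖x‖ ^ 2 := by
    rw [hA_def, hx₁]; exact norm_sub_cutLp_sq_le_of_inClass hw₀ hR Lc
  have hcoef0 : 0 ≤ Cτ * ρ ^ στ * (Lc : ℝ) ^ 2 := by positivity
  have hA : 4 * Real.pi ^ 2 * A ≤ Cτ * ρ ^ στ * D := by
    have hL1 : 0 < (Lc : ℝ) ^ 2 + 1 := by positivity
    have h1 : ((Lc : ℝ) ^ 2 + 1) * (4 * Real.pi ^ 2 * A) ≤ ((Lc : ℝ) ^ 2 + 1) * (Cτ * ρ ^ στ * D) :=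
      calc ((Lc : ℝ) ^ 2 + 1) * (4 * Real.pi ^ 2 * A) = 4 * Real.pi ^ 2 * ((Lc : ℝ) ^ 2 + 1) * A := by ring
        _ ≤ (R : ℝ) * ‖x‖ ^ 2 := hgap
        _ ≤ Cτ * ρ ^ στ * (Lc : ℝ) ^ 2 * B * ‖x‖ ^ 2 := mul_le_mul_of_nonneg_right htrim (sq_nonneg _)
        _ = Cτ * ρ ^ στ * (Lc : ℝ) ^ 2 * (B * ‖x‖ ^ 2) := by ring
        _ ≤ Cτ * ρ ^ στ * (Lc : ℝ) ^ 2 * D := mul_le_mul_of_nonneg_left hBD hcoef0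
        _ ≤ Cτ * ρ ^ στ * ((Lc : ℝ) ^ 2 + 1) * D :=
          mul_le_mul_of_nonneg_right (mul_le_mul_of_nonneg_left (by linarith) (by positivity)) hD0
        _ = ((Lc : ℝ) ^ 2 + 1) * (Cτ * ρ ^ στ * D) := by ring
    exact le_of_mul_le_mul_left h1 hL1
  -- AM–GM with weight `δ := ρ^{στ/2}`: `6‖x₂‖√D ≤ 3(A/δ + δD)`, and `A ≤ Cτ' δ² D`
  set Cτ' : ℝ := Cτ / (4 * Real.pi ^ 2) with hCτ'_def
  have hCτ'0 : 0 ≤ Cτ' := by positivity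
  set δ : ℝ := ρ ^ (στ / 2) with hδ_def
  have hδ : 0 < δ := Real.rpow_pos_of_pos hρpos _
  have hδ1 : δ ≤ 1 := Real.rpow_le_one hρ0 hρ1 (half_pos hστ).le
  have hδδ : ρ ^ στ = δ * δ := by rw [hδ_def, ← Real.rpow_add hρpos, add_halves]
  have hA' : A ≤ Cτ' * (δ * δ) * D := by
    rw [hCτ'_def, ← hδδ]
    have hπ : 0 < 4 * Real.pi ^ 2 := by positivity
    rw [div_mul_eq_mul_div, div_mul_eq_mul_div, le_div_iff₀ hπ]
    linarith only [hA]
  have hsq : Real.sqrt D ^ 2 = D := Real.sq_sqrt hD0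
  have hamgm : 6 * ‖x - x₁‖ * Real.sqrt D * δ ≤ 3 * A + 3 * (δ * δ) * D := by
    have hid : 3 * ‖x - x₁‖ ^ 2 + 3 * (δ * δ) * Real.sqrt D ^ 2 - 6 * ‖x - x₁‖ * Real.sqrt D * δ =
        3 * (‖x - x₁‖ - δ * Real.sqrt D) ^ 2 := by ring
    rw [hsq] at hid
    have h0 : 0 ≤ 3 * (‖x - x₁‖ - δ * Real.sqrt D) ^ 2 := by positivity
    rw [hA_def]; linarith only [hid, h0]
  -- `6‖x₂‖√D ≤ 3 Cτ' δ D + 3 δ D` (divide the AM–GM by δ > 0 after inserting `A ≤ Cτ' δ² D`)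
  have hcross : 6 * ‖x - x₁‖ * Real.sqrt D ≤ (3 * Cτ' + 3) * δ * D := by
    have h1 : 6 * ‖x - x₁‖ * Real.sqrt D * δ ≤ ((3 * Cτ' + 3) * δ * D) * δ := by
      have : 3 * A ≤ 3 * (Cτ' * (δ * δ) * D) := by linarith [hA']
      have hre : ((3 * Cτ' + 3) * δ * D) * δ = 3 * (Cτ' * (δ * δ) * D) + 3 * (δ * δ) * D := by ring
      rw [hre]; linarith only [hamgm, this]
    exact le_of_mul_le_mul_right h1 hδ
  have htail15 : 15 * ‖x - x₁‖ ^ 2 ≤ 15 * Cτ' * δ * D := by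
    have : A ≤ Cτ' * δ * D := by
      calc A ≤ Cτ' * (δ * δ) * D := hA'
        _ ≤ Cτ' * (δ * 1) * D := by
          exact mul_le_mul_of_nonneg_right (mul_le_mul_of_nonneg_left (mul_le_mul_of_nonneg_left hδ1 hδ.le) hCτ'0) hD0
        _ = Cτ' * δ * D := by ring
    rw [← hA_def]; linarith only [this]
  -- exponents: every rate is at least `σ₁ := min (min ση σg) (στ/2)`
  have hρpow : ∀ {s : ℝ}, min (min ση σg) (στ / 2) ≤ s → ρ ^ s ≤ ρ ^ min (min ση σg) (στ / 2) := fun hs =>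
    Real.rpow_le_rpow_of_exponent_ge' hρ0 hρ1 (lt_min (lt_min hση hσg) (half_pos hστ)).le hs
  have h1 := mul_le_mul_of_nonneg_left (hρpow ((min_le_left _ _).trans (min_le_left ση σg))) hCη.le
  have h2 := mul_le_mul_of_nonneg_left (hρpow ((min_le_left _ _).trans (min_le_right ση σg))) hCg.le
  have h3 : δ ≤ ρ ^ min (min ση σg) (στ / 2) := hρpow (min_le_right _ _)
  have hminε : min ε₁ 1 ≤ ε₁ := min_le_left _ _
  have hX : 2 * ε₁ + ((3 * Cτ' + 3) * δ + 15 * Cτ' * δ) ≤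
      (2 * (3 * Cη + 12 * Cg) + (18 * (Cτ / (4 * Real.pi ^ 2)) + 3)) * ρ ^ min (min ση σg) (στ / 2) := by
    rw [hε₁_def, ← hCτ'_def]
    have h4 := mul_le_mul_of_nonneg_left h3 (show (0:ℝ) ≤ 18 * Cτ' + 3 by positivity)
    linarith only [h1, h2, h4]
  have hmain : ‖Um1 0 t x‖ ^ 2 ≤ ‖Um 0 t x‖ ^ 2 + (2 * ε₁ + ((3 * Cτ' + 3) * δ + 15 * Cτ' * δ)) * D := by
    have h2ε : 2 * min ε₁ 1 * D ≤ 2 * ε₁ * D :=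
      mul_le_mul_of_nonneg_right (mul_le_mul_of_nonneg_left hminε zero_le_two) hD0
    linarith only [htc, h2ε, hcross, htail15, hA_def]
  have hXD := mul_le_mul_of_nonneg_right hX hD0
  simp only [drop]
  rw [hEu, hEv, hE0, ← hD_def]
  linarith only [hmain, hXD, hD_def]

end Summit.AnomalousDissipation.AnomalousDissipation.Theorems.SolenoidalFractalHomogenisation.LagrangianStep

end
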